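import Literature.Analysis.FluidPDE.Onsager1949
import Literature.Analysis.FluidPDE.ConvexIntegration2DBallProofs
import Literature.Analysis.FluidPDE.DistributionalToWeak
import Literature.Analysis.FluidPDE.TwoHalfWeakEuler
import Literature.Analysis.FunctionSpaces.FlatTorusProofs
import HarnessLib

/-!
# Onsager 1949, dissipation without viscosity: proof of `Onsager1949_inviscidDissipation`

Analysis/FluidPDE proofs file (sibling of `Onsager1949.lean`; the other claim of that file,
`Onsager1949_energyConservation`, is discharged in `Onsager1949Proofs.lean`). The named fact
`Literature.Analysis.FluidPDE.Onsager1949_inviscidDissipation` — *there is a weak solution of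
incompressible Euler on `T³ × (0,T)`, `T > 0`, whose kinetic energy is not a.e. constant in
time* (Onsager 1949, closing paragraph; proved in print by Scheffer 1993, Shnirelman 1997 and
De Lellis–Székelyhidi, Ann. Math. 170 (2009), Thm. 1.1, by convex integration) — is discharged
here **without any unproved input**, from the tree's fully proved two-dimensional
convex-integration lemma `ConvexIntegration.convexIntegrationLemma2D_holds`
(Chiodaroli–De Lellis–Kreml 2015, Lemma 3.7 = De Lellis–Székelyhidi's localized oscillation
lemma for the linearised pressureless Euler system).

## Proof architecture

1. *A compactly supported planar weak Euler flow* (`§A`). Apply the lemma with `v₀ = 0`,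
   `u₀ = 0`, `C = 2` on the space–time cylinder `Ω = (1/4, 3/4) × B`, `B = B(c, 1/8)`,
   `c = (1/2, 1/2)`: a bounded measurable `v` with `|v|² = 2` a.e. on `Ω`,
   `div (𝟙_Ω v) = 0` and `∂ₜ(𝟙_Ω v) + div (𝟙_Ω (v ⊗ v - Id)) = 0` in `𝒟'(ℝ × ℝ²)`. Hence
   `u := 𝟙_Ω v`, `p := -𝟙_Ω` is a distributional Euler solution on `(0,1) × ℝ²`
   (`IsDistributionalNSSolutionOn`, `planar_isDistributional`), vanishing for `t ∉ (1/4, 3/4)`.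
2. *Pressure-free form* (`§B`). By the tree's proved Caffarelli–Kohn–Nirenberg bridge
   `IsDistributionalNSSolutionOn.isWeakNSSolutionOn_datum` it is a whole-space weak Euler
   solution with datum `0`; in particular `u(t)` is weakly divergence free for a.e. `t`.
3. *Transplant to `T²`* (`§C`). `B̄ ⊂ (0,1)²`, so `U₂(t) := u(t) ∘ repr` is a weak Euler solution
   on `T² × (0,1)` (`Torus.IsWeakNSSolutionOn`): periodic test fields are localized to the
   fundamental square by a smooth cut-off equal to `1` near `B̄`, which does not change any
   pairing with `u`.
4. *`2½`-dimensional lift* (`§D`). `U₃(t) := (U₂(t), 0) ∘ π` is a weak Euler solution on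
   `T³ × (0,1)` (Bardos–Titi–Wiedemann lift with zero vertical component; the tree's
   `TwoHalfWeakEuler` calculus).
5. *Energy* (`§E`). `E(U₃(t)) = 0` for `t < 1/4` and `E(U₃(t)) = |B| > 0` for a.e.
   `t ∈ (1/4, 3/4)`, so the energy is not a.e. constant on `(0,1)`.

## References

* L. Onsager, *Statistical hydrodynamics*, Nuovo Cimento (9) 6, Suppl. 2 (1949), 279–287.
* C. De Lellis, L. Székelyhidi Jr., *The Euler equations as a differential inclusion*, Ann. of
  Math. 170 (2009), Thm. 1.1 and §4.
* E. Chiodaroli, C. De Lellis, O. Kreml, Comm. Pure Appl. Math. 68 (2015), Lemma 3.7.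
* C. Bardos, E. S. Titi, E. Wiedemann, C. R. Math. 350 (2012), proof of Cor. 2.
-/

noncomputable section

open MeasureTheory TopologicalSpace Set Function Filter Topology Metric
open scoped RealInnerProductSpace ENNReal NNReal Laplacian

namespace Literature.Analysis.FluidPDE

namespace Onsager1949

open ConvexIntegration

/-- Euclidean `ℝ²`, local notation. -/
local notation "E²" => EuclideanSpace ℝ (Fin 2)

/-! ## §A The planar convex-integration flow on `ℝ × ℝ²` -/

section Planar

/-- The centre `c = (1/2, 1/2)` of the unit square. [folklore] -/
def ctr : E² := WithLp.toLp 2 fun _ => (1 / 2 : ℝ)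

/-- Coordinates of the centre. [folklore] -/
@[simp] theorem ctr_apply (i : Fin 2) : ctr i = 1 / 2 := rfl

/-- The disc `B = B(c, 1/8)` carrying the flow. [folklore] -/
def disc : Set E² := ball ctr (1 / 8)

/-- The space–time cylinder `Ω = (1/4, 3/4) × B`. [folklore] -/
def cyl : Set (ℝ × E²) := Ioo (1 / 4 : ℝ) (3 / 4) ×ˢ disc

/-- The disc `B` is open. [folklore] -/
theorem isOpen_disc : IsOpen disc := isOpen_ball

/-- The disc `B` is measurable. [folklore] -/
theorem measurableSet_disc : MeasurableSet disc := isOpen_disc.measurableSet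

/-- The cylinder `Ω` is open. [folklore] -/
theorem isOpen_cyl : IsOpen cyl := isOpen_Ioo.prod isOpen_disc

/-- The cylinder `Ω` is measurable. [folklore] -/
theorem measurableSet_cyl : MeasurableSet cyl := isOpen_cyl.measurableSet

/-- The cylinder `Ω` is non-empty (it contains `(1/2, c)`). [folklore] -/
theorem cyl_nonempty : cyl.Nonempty :=
  ⟨((1 / 2 : ℝ), ctr), ⟨by norm_num, by norm_num⟩, mem_ball_self (by norm_num)⟩

/-- Membership in the cylinder. [folklore] -/
theorem mem_cyl {z : ℝ × E²} : z ∈ cyl ↔ z.1 ∈ Ioo (1 / 4 : ℝ) (3 / 4) ∧ z.2 ∈ disc :=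
  mem_prod

/-- The disc has finite area. [folklore] -/
theorem volume_disc_lt_top : volume disc < ∞ := measure_ball_lt_top

/-- The disc has positive area. [folklore] -/
theorem volume_disc_pos : 0 < volume disc := measure_ball_pos _ _ (by norm_num)

/-- The cylinder has finite volume. [folklore] -/
theorem volume_cyl_lt_top : volume cyl < ∞ := by
  rw [cyl, Measure.volume_eq_prod, Measure.prod_prod]
  exact ENNReal.mul_lt_top measure_Ioo_lt_top volume_disc_lt_top

/-- The strict subsolution condition of the lemma for the rest state at energy level `C = 2`:
`(2/2) Id - (0 ⊗ 0 - 0) = Id` is positive definite. [folklore] -/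
theorem posDef_rest :
    (((2 : ℝ) / 2) • (1 : Matrix (Fin 2) (Fin 2) ℝ) -
      (Matrix.vecMulVec (0 : E²) (0 : E²) - 0)).PosDef := by
  have h : (((2 : ℝ) / 2) • (1 : Matrix (Fin 2) (Fin 2) ℝ) -
      (Matrix.vecMulVec (0 : E²) (0 : E²) - 0)) = 1 := by
    ext i j
    simp [Matrix.one_apply]
  rw [h]
  exact Matrix.PosDef.one

/-- **The convex-integration field.** There is a measurable `V : ℝ × ℝ² → ℝ²`, bounded by `2`
everywhere, with `|V|² = 2` a.e. on `Ω`, such that `𝟙_Ω V` is divergence free and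
`∂ₜ(𝟙_Ω V) + div(𝟙_Ω (V ⊗ V - Id)) = 0` in the sense of distributions on `ℝ × ℝ²`
(Chiodaroli–De Lellis–Kreml 2015, Lemma 3.7 with `v₀ = 0`, `u₀ = 0`, `C = 2`, truncated on the
null set where `|V|² ≠ 2`). [cite: ChiodaroliDeLellisKreml2015, Lemma 3.7] -/
theorem exists_cdkField :
    ∃ V : ℝ × E² → E², Measurable V ∧ (∀ z, ‖V z‖ ≤ 2) ∧
      (∀ᵐ z ∂(volume.restrict cyl), ‖V z‖ ^ 2 = 2) ∧
      (∀ φ : ℝ × E² → ℝ, FunctionSpaces.IsTestFunctionOn ⊤ φ →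
        ∫ z in cyl, ∑ j, V z j * fderiv ℝ φ z (0, EuclideanSpace.single j 1) = 0) ∧
      (∀ w : ℝ × E² → E², FunctionSpaces.IsTestFunctionOn ⊤ w →
        ∫ z in cyl, (∑ i, V z i * fderiv ℝ w z (1, 0) i +
          ∑ i, ∑ j, (V z i * V z j - (if i = j then 1 else 0)) *
            fderiv ℝ w z (0, EuclideanSpace.single j 1) i) = 0) := by
  obtain ⟨v, -, hv⟩ := convexIntegrationLemma2D_holds cyl isOpen_cyl cyl_nonempty 0 0 2
    Matrix.isSymm_zero (Matrix.trace_zero _ _) two_pos posDef_rest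
  obtain ⟨hvm, hv2, hdiv, hmom⟩ := hv 0
  set V : ℝ × E² → E² := v 0 with hV
  -- truncation on the null set where `‖V‖ > 2`
  set W : ℝ × E² → E² := fun z => if ‖V z‖ ≤ 2 then V z else 0 with hW
  have hWm : Measurable W :=
    Measurable.ite (measurableSet_le hvm.norm measurable_const) hvm measurable_const
  have hWb : ∀ z, ‖W z‖ ≤ 2 := fun z => by
    by_cases h : ‖V z‖ ≤ 2
    · simp [hW, h]
    · simp [hW, h]
  have hWV : ∀ᵐ z ∂(volume.restrict cyl), W z = V z := by
    filter_upwards [hv2] with z hz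
    have h1 : ‖V z‖ ≤ 2 := by nlinarith [norm_nonneg (V z)]
    simp [hW, h1]
  refine ⟨W, hWm, hWb, ?_, fun φ hφ => ?_, fun w hw => ?_⟩
  · filter_upwards [hWV, hv2] with z h1 h2
    rw [h1, h2]
  · refine Eq.trans (integral_congr_ae ?_) (hdiv φ hφ)
    filter_upwards [hWV] with z hz
    simp [hz]
  · refine Eq.trans (integral_congr_ae ?_) (hmom w hw)
    filter_upwards [hWV] with z hz
    simp only [hz, WithLp.ofLp_zero, Pi.zero_apply, sub_zero, Matrix.zero_apply]
    norm_num

/-- The convex-integration field `V` of `exists_cdkField` (a choice). [folklore] -/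
def cdkField : ℝ × E² → E² := Classical.choose exists_cdkField

/-- `V` is measurable. [folklore] -/
theorem measurable_cdkField : Measurable cdkField := (Classical.choose_spec exists_cdkField).1

/-- `‖V‖ ≤ 2` everywhere. [folklore] -/
theorem norm_cdkField_le (z : ℝ × E²) : ‖cdkField z‖ ≤ 2 :=
  (Classical.choose_spec exists_cdkField).2.1 z

/-- `|V|² = 2` a.e. on the cylinder. [folklore] -/
theorem ae_norm_sq_cdkField : ∀ᵐ z ∂(volume.restrict cyl), ‖cdkField z‖ ^ 2 = 2 :=
  (Classical.choose_spec exists_cdkField).2.2.1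

/-- The distributional divergence identity of `𝟙_Ω V` (lemma clause (ii), first half). [folklore] -/
theorem cdkField_div {φ : ℝ × E² → ℝ} (hφ : FunctionSpaces.IsTestFunctionOn ⊤ φ) :
    ∫ z in cyl, ∑ j, cdkField z j * fderiv ℝ φ z (0, EuclideanSpace.single j 1) = 0 :=
  (Classical.choose_spec exists_cdkField).2.2.2.1 φ hφ

/-- The distributional momentum identity of `𝟙_Ω V` (lemma clause (ii), second half, with
(iii)). [folklore] -/
theorem cdkField_mom {w : ℝ × E² → E²} (hw : FunctionSpaces.IsTestFunctionOn ⊤ w) :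
    ∫ z in cyl, (∑ i, cdkField z i * fderiv ℝ w z (1, 0) i +
      ∑ i, ∑ j, (cdkField z i * cdkField z j - (if i = j then 1 else 0)) *
        fderiv ℝ w z (0, EuclideanSpace.single j 1) i) = 0 :=
  (Classical.choose_spec exists_cdkField).2.2.2.2 w hw

/-- **The planar velocity** `u = 𝟙_Ω V` on `ℝ × ℝ²` (time first, curried). [folklore] -/
def uW : ℝ → E² → E² := fun t Y => cyl.indicator cdkField (t, Y)

/-- **The planar pressure** `p = -𝟙_Ω`. [folklore] -/
def pW : ℝ → E² → ℝ := fun t Y => cyl.indicator (fun _ => (-1 : ℝ)) (t, Y)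

/-- `u` uncurried is the indicator of the cylinder times `V`. [folklore] -/
theorem uncurry_uW : uncurry uW = cyl.indicator cdkField := by
  funext z; rfl

/-- `p` uncurried is `-𝟙_Ω`. [folklore] -/
theorem uncurry_pW : uncurry pW = cyl.indicator fun _ => (-1 : ℝ) := by
  funext z; rfl

/-- `u = V` on the cylinder. [folklore] -/
theorem uW_of_mem {t : ℝ} {Y : E²} (h : (t, Y) ∈ cyl) : uW t Y = cdkField (t, Y) :=
  indicator_of_mem h _

/-- `u = 0` off the cylinder. [folklore] -/
theorem uW_of_not_mem {t : ℝ} {Y : E²} (h : (t, Y) ∉ cyl) : uW t Y = 0 :=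
  indicator_of_notMem h _

/-- `p = -1` on the cylinder. [folklore] -/
theorem pW_of_mem {t : ℝ} {Y : E²} (h : (t, Y) ∈ cyl) : pW t Y = -1 :=
  indicator_of_mem h _

/-- `p = 0` off the cylinder. [folklore] -/
theorem pW_of_not_mem {t : ℝ} {Y : E²} (h : (t, Y) ∉ cyl) : pW t Y = 0 :=
  indicator_of_notMem h _

/-- The velocity vanishes outside the time interval `(1/4, 3/4)`. [folklore] -/
theorem uW_eq_zero_of_time {t : ℝ} (ht : t ∉ Ioo (1 / 4 : ℝ) (3 / 4)) : uW t = 0 := by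
  funext Y
  exact uW_of_not_mem fun h => ht (mem_cyl.1 h).1

/-- The velocity vanishes outside the disc `B`. [folklore] -/
theorem uW_eq_zero_of_space {t : ℝ} {Y : E²} (hY : Y ∉ disc) : uW t Y = 0 :=
  uW_of_not_mem fun h => hY (mem_cyl.1 h).2

/-- `u` is jointly measurable. [folklore] -/
theorem measurable_uncurry_uW : Measurable (uncurry uW) := by
  rw [uncurry_uW]
  exact measurable_cdkField.indicator measurableSet_cyl

/-- `p` is jointly measurable. [folklore] -/
theorem measurable_uncurry_pW : Measurable (uncurry pW) := by
  rw [uncurry_pW]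
  exact measurable_const.indicator measurableSet_cyl

/-- Every time slice of `u` is measurable. [folklore] -/
theorem measurable_uW (t : ℝ) : Measurable (uW t) :=
  measurable_uncurry_uW.comp (measurable_const.prodMk measurable_id)

/-- `‖u‖ ≤ 2` everywhere. [folklore] -/
theorem norm_uW_le (t : ℝ) (Y : E²) : ‖uW t Y‖ ≤ 2 := by
  by_cases h : (t, Y) ∈ cyl
  · rw [uW_of_mem h]; exact norm_cdkField_le _
  · rw [uW_of_not_mem h, norm_zero]; norm_num

/-- `‖p‖ ≤ 1` everywhere. [folklore] -/
theorem norm_pW_le (t : ℝ) (Y : E²) : ‖pW t Y‖ ≤ 1 := by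
  by_cases h : (t, Y) ∈ cyl
  · rw [pW_of_mem h]; simp
  · rw [pW_of_not_mem h, norm_zero]; norm_num

/-- `u` is integrable on `ℝ × ℝ²` (bounded, supported in the bounded cylinder). [folklore] -/
theorem integrable_uncurry_uW : Integrable (uncurry uW) volume := by
  rw [uncurry_uW, integrable_indicator_iff measurableSet_cyl]
  exact IntegrableOn.of_bound volume_cyl_lt_top
    measurable_cdkField.aestronglyMeasurable.restrict 2 (ae_of_all _ norm_cdkField_le)

/-- `|u|²` is integrable on `ℝ × ℝ²`. [folklore] -/
theorem integrable_norm_sq_uW : Integrable (fun z => ‖uncurry uW z‖ ^ 2) volume := by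
  have h : (fun z => ‖uncurry uW z‖ ^ 2) = cyl.indicator fun z => ‖cdkField z‖ ^ 2 := by
    funext z
    rw [uncurry_uW]
    by_cases hz : z ∈ cyl <;> simp [hz]
  rw [h, integrable_indicator_iff measurableSet_cyl]
  refine IntegrableOn.of_bound volume_cyl_lt_top
    (measurable_cdkField.norm.pow_const 2).aestronglyMeasurable.restrict 4
    (ae_of_all _ fun z => ?_)
  rw [Real.norm_eq_abs, abs_of_nonneg (sq_nonneg _)]
  nlinarith [norm_cdkField_le z, norm_nonneg (cdkField z)]

/-- `p` is integrable on `ℝ × ℝ²`. [folklore] -/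
theorem integrable_uncurry_pW : Integrable (uncurry pW) volume := by
  rw [uncurry_pW, integrable_indicator_iff measurableSet_cyl]
  exact integrableOn_const volume_cyl_lt_top.ne


/-! ### Slice derivatives versus joint derivatives (whole space) -/

variable {F : Type*} [NormedAddCommGroup F] [NormedSpace ℝ F]

/-- The time derivative of a jointly differentiable field is the joint derivative in the
direction `(1, 0)`. [folklore] -/
theorem timeDeriv_eq_fderiv_uncurry {ψ : ℝ → E² → F} (hψ : Differentiable ℝ (uncurry ψ))
    (z : ℝ × E²) : timeDeriv ψ z.1 z.2 = fderiv ℝ (uncurry ψ) z ((1 : ℝ), (0 : E²)) := by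
  rw [timeDeriv_apply, ← fderiv_apply_one_eq_deriv]
  exact FunctionSpaces.Torus.fderiv_curry_time_apply_one (f := uncurry ψ) (p := z) (hψ z)

/-- The spatial derivative of a slice of a jointly differentiable field is the joint derivative
in the direction `(0, v)`. [folklore] -/
theorem fderiv_slice_apply {ψ : ℝ → E² → F} (hψ : Differentiable ℝ (uncurry ψ)) (z : ℝ × E²)
    (v : E²) : fderiv ℝ (ψ z.1) z.2 v = fderiv ℝ (uncurry ψ) z ((0 : ℝ), v) := by
  have hg : HasFDerivAt (fun Y : E² => (z.1, Y)) (ContinuousLinearMap.inr ℝ ℝ E²) z.2 :=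
    hasFDerivAt_prodMk_right z.1 z.2
  have hc : HasFDerivAt (fun Y : E² => uncurry ψ (z.1, Y))
      ((fderiv ℝ (uncurry ψ) z).comp (ContinuousLinearMap.inr ℝ ℝ E²)) z.2 :=
    (hψ (z.1, z.2)).hasFDerivAt.comp z.2 hg
  have h : (fun Y : E² => uncurry ψ (z.1, Y)) = ψ z.1 := rfl
  rw [h] at hc
  rw [hc.fderiv]
  rfl

/-- A vector of `ℝ²` in the basis `e₀, e₁`. [folklore] -/
theorem eq_smul_single_add (a : E²) :
    a = a 0 • EuclideanSpace.single 0 (1 : ℝ) + a 1 • EuclideanSpace.single 1 (1 : ℝ) := by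
  ext i
  fin_cases i <;> simp

/-- The real inner product on `ℝ²` in coordinates. [folklore] -/
theorem inner_two (a b : E²) : ⟪a, b⟫ = a 0 * b 0 + a 1 * b 1 := by
  simp [PiLp.inner_apply, Fin.sum_univ_two, mul_comm]

/-- A linear map applied to `(0, a)`, in coordinates. [folklore] -/
theorem clm_apply_zero_prod {G : Type*} [NormedAddCommGroup G] [NormedSpace ℝ G]
    (L : ℝ × E² →L[ℝ] G) (a : E²) :
    L ((0 : ℝ), a) = a 0 • L ((0 : ℝ), EuclideanSpace.single 0 (1 : ℝ)) +
      a 1 • L ((0 : ℝ), EuclideanSpace.single 1 (1 : ℝ)) := by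
  have h : ((0 : ℝ), a) = a 0 • ((0 : ℝ), EuclideanSpace.single 0 (1 : ℝ)) +
      a 1 • ((0 : ℝ), EuclideanSpace.single 1 (1 : ℝ)) := by
    conv_lhs => rw [eq_smul_single_add a]
    ext
    · simp
    · simp
  rw [h, map_add, map_smul, map_smul]

/-- The divergence of a slice in terms of the joint derivative. [folklore] -/
theorem divergence_slice_eq {ψ : ℝ → E² → E²} (hψ : Differentiable ℝ (uncurry ψ)) (z : ℝ × E²) :
    VectorCalculus.divergence (ψ z.1) z.2 =
      fderiv ℝ (uncurry ψ) z ((0 : ℝ), EuclideanSpace.single 0 (1 : ℝ)) 0 +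
        fderiv ℝ (uncurry ψ) z ((0 : ℝ), EuclideanSpace.single 1 (1 : ℝ)) 1 := by
  rw [divergence_eq_sum_inner_fderiv (EuclideanSpace.basisFun (Fin 2) ℝ), Fin.sum_univ_two]
  simp only [EuclideanSpace.basisFun_apply, fderiv_slice_apply hψ, EuclideanSpace.inner_single_left,
    map_one, one_mul]

/-- **The divergence integrand on the cylinder.** [folklore] -/
theorem divIntegrand_eq {θ : ℝ → E² → ℝ} (hθ : Differentiable ℝ (uncurry θ)) {z : ℝ × E²}
    (hz : z ∈ cyl) :
    ⟪uW z.1 z.2, gradient (θ z.1) z.2⟫ =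
      ∑ j, cdkField z j * fderiv ℝ (uncurry θ) z (0, EuclideanSpace.single j 1) := by
  have hu : uW z.1 z.2 = cdkField z := indicator_of_mem hz _
  rw [hu, real_inner_comm, ← InnerProductSpace.toDual_apply_apply (𝕜 := ℝ), toDual_gradient,
    fderiv_slice_apply hθ, clm_apply_zero_prod, Fin.sum_univ_two]
  simp only [smul_eq_mul]

/-- **The momentum integrand on the cylinder**: with `u = V`, `p = -1` the pressure-explicit
Euler integrand is the integrand of the convex-integration lemma. [folklore] -/
theorem momIntegrand_eq {ψ : ℝ → E² → E²} (hψ : Differentiable ℝ (uncurry ψ)) {z : ℝ × E²}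
    (hz : z ∈ cyl) :
    ⟪uW z.1 z.2, timeDeriv ψ z.1 z.2⟫ + ⟪uW z.1 z.2, convect (uW z.1) (ψ z.1) z.2⟫ +
        0 * ⟪uW z.1 z.2, Δ (ψ z.1) z.2⟫ + pW z.1 z.2 * VectorCalculus.divergence (ψ z.1) z.2 +
        ⟪(0 : ℝ → E² → E²) z.1 z.2, ψ z.1 z.2⟫ =
      ∑ i, cdkField z i * fderiv ℝ (uncurry ψ) z (1, 0) i +
        ∑ i, ∑ j, (cdkField z i * cdkField z j - (if i = j then 1 else 0)) *
          fderiv ℝ (uncurry ψ) z (0, EuclideanSpace.single j 1) i := by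
  have hu : uW z.1 z.2 = cdkField z := indicator_of_mem hz _
  have hp : pW z.1 z.2 = -1 := indicator_of_mem hz _
  rw [convect_apply, hu, hp, timeDeriv_eq_fderiv_uncurry hψ, fderiv_slice_apply hψ,
    clm_apply_zero_prod, divergence_slice_eq hψ]
  simp only [Fin.sum_univ_two, inner_two, PiLp.add_apply, PiLp.smul_apply, smul_eq_mul,
    Pi.zero_apply, inner_zero_left, zero_mul, add_zero, Fin.isValue]
  simp
  ring

/-- The cylinder lies in the slab `(0,1) × ℝ²`. [folklore] -/
theorem cyl_subset_slab : cyl ⊆ Ioo (0 : ℝ) 1 ×ˢ (univ : Set E²) :=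
  prod_mono (Ioo_subset_Ioo (by norm_num) (by norm_num)) (subset_univ _)

/-- **The planar flow is a distributional Euler solution on `(0,1) × ℝ²`** with pressure
`p = -𝟙_Ω` and no force (De Lellis–Székelyhidi 2009, §1 eq. (1) in `𝒟'`): the divergence and
momentum identities are those of the convex-integration lemma, read through
`divIntegrand_eq` / `momIntegrand_eq`. [cite: ChiodaroliDeLellisKreml2015, Lemma 3.7] -/
theorem planar_isDistributional :
    IsDistributionalNSSolutionOn (slab E² (Ioo 0 1) isOpen_Ioo) 0 0 uW pW := by
  refine ⟨integrable_uncurry_uW.locallyIntegrable.locallyIntegrableOn _,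
    integrable_norm_sq_uW.locallyIntegrable.locallyIntegrableOn _,
    integrable_uncurry_pW.locallyIntegrable.locallyIntegrableOn _, fun θ hθ => ?_, fun ψ hψ => ?_⟩
  · have hd : Differentiable ℝ (uncurry θ) := hθ.contDiff.differentiable (by simp)
    have hpt : ∀ z : ℝ × E², ⟪uW z.1 z.2, gradient (θ z.1) z.2⟫ =
        cyl.indicator (fun z => ∑ j, cdkField z j *
          fderiv ℝ (uncurry θ) z (0, EuclideanSpace.single j 1)) z := by
      intro z
      by_cases hz : z ∈ cyl
      · rw [indicator_of_mem hz]
        exact divIntegrand_eq hd hz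
      · rw [indicator_of_notMem hz, show uW z.1 z.2 = 0 from indicator_of_notMem hz _,
          inner_zero_left]
    simp_rw [hpt]
    rw [setIntegral_indicator measurableSet_cyl, coe_slab, inter_eq_right.2 cyl_subset_slab]
    exact cdkField_div (hθ.mono le_top)
  · have hd : Differentiable ℝ (uncurry ψ) := hψ.contDiff.differentiable (by simp)
    have hpt : ∀ z : ℝ × E²,
        ⟪uW z.1 z.2, timeDeriv ψ z.1 z.2⟫ + ⟪uW z.1 z.2, convect (uW z.1) (ψ z.1) z.2⟫ +
          0 * ⟪uW z.1 z.2, Δ (ψ z.1) z.2⟫ + pW z.1 z.2 * VectorCalculus.divergence (ψ z.1) z.2 +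
          ⟪(0 : ℝ → E² → E²) z.1 z.2, ψ z.1 z.2⟫ =
        cyl.indicator (fun z => ∑ i, cdkField z i * fderiv ℝ (uncurry ψ) z (1, 0) i +
          ∑ i, ∑ j, (cdkField z i * cdkField z j - (if i = j then 1 else 0)) *
            fderiv ℝ (uncurry ψ) z (0, EuclideanSpace.single j 1) i) z := by
      intro z
      by_cases hz : z ∈ cyl
      · rw [indicator_of_mem hz]
        exact momIntegrand_eq hd hz
      · rw [indicator_of_notMem hz, show uW z.1 z.2 = 0 from indicator_of_notMem hz _,
          show pW z.1 z.2 = 0 from indicator_of_notMem hz _]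
        simp
    simp_rw [hpt]
    rw [setIntegral_indicator measurableSet_cyl, coe_slab, inter_eq_right.2 cyl_subset_slab]
    exact cdkField_mom (hψ.mono le_top)

end Planar

/-! ## §B Pressure-free form: a whole-space weak Euler solution with datum `0` -/

section WholeSpaceWeak

/-- `‖a‖ₑ² ≤ 4` for `‖a‖ ≤ 2`. [folklore] -/
theorem enorm_sq_le_four {G : Type*} [NormedAddCommGroup G] {a : G} (h : ‖a‖ ≤ 2) :
    ‖a‖ₑ ^ 2 ≤ 4 := by
  rw [← ofReal_norm, ← ENNReal.ofReal_pow (norm_nonneg _)]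
  have h4 : ‖a‖ ^ 2 ≤ 4 := by nlinarith [norm_nonneg a]
  calc ENNReal.ofReal (‖a‖ ^ 2) ≤ ENNReal.ofReal 4 := ENNReal.ofReal_le_ofReal h4
    _ = 4 := by norm_num

/-- `u` is square integrable on every finite cylinder `(0,1) × K`. [folklore] -/
theorem lintegral_uW_sq_lt_top (K : Set E²) (hK : IsCompact K) :
    ∫⁻ z in Ioo (0 : ℝ) 1 ×ˢ K, ‖uncurry uW z‖ₑ ^ 2 < ∞ := by
  calc ∫⁻ z in Ioo (0 : ℝ) 1 ×ˢ K, ‖uncurry uW z‖ₑ ^ 2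
      ≤ ∫⁻ _ in Ioo (0 : ℝ) 1 ×ˢ K, (4 : ℝ≥0∞) :=
        lintegral_mono fun z => enorm_sq_le_four (norm_uW_le z.1 z.2)
    _ = 4 * volume (Ioo (0 : ℝ) 1 ×ˢ K) := setLIntegral_const _ _
    _ < ∞ := ENNReal.mul_lt_top (by simp) (volume_Ioo_prod_lt_top hK)

/-- **The planar flow is a whole-space weak Euler solution on `ℝ² × [0,1)` with datum `0`**
(pressure-free form, tested against divergence-free fields), by the tree's proved
Caffarelli–Kohn–Nirenberg bridge `IsDistributionalNSSolutionOn.isWeakNSSolutionOn_datum`; the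
datum `0` is attained trivially since `u(t) = 0` for `t < 1/4`. [cite: LellisSzekelyhidi2009, §1] -/
theorem planar_isWeak : IsWeakNSSolutionOn (1 : ℝ) 0 (0 : ℝ → E² → E²) (0 : E² → E²) uW := by
  refine planar_isDistributional.isWeakNSSolutionOn_datum lintegral_uW_sq_lt_top
    (fun K _ => integrableOn_zero) aestronglyMeasurable_const (fun K _ => ?_)
  have h : (fun t : ℝ => ∫⁻ x in K, ‖uW t x - (0 : E² → E²) x‖ₑ ^ 2) =ᶠ[𝓝[>] (0 : ℝ)]
      fun _ => 0 := by
    filter_upwards [Ioo_mem_nhdsGT (show (0 : ℝ) < 1 / 4 by norm_num)] with t ht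
    have h0 : uW t = 0 := uW_eq_zero_of_time fun h => by linarith [h.1, ht.2]
    simp [h0]
  rw [tendsto_congr' h]
  exact tendsto_const_nhds

/-- For a.e. `t ∈ (0,1)` the slice `u(t)` is weakly divergence free on `ℝ²`. [folklore] -/
theorem ae_isWeaklyDivFree_uW :
    ∀ᵐ t ∂(volume.restrict (Ioo (0 : ℝ) 1)), IsWeaklyDivFree (uW t) :=
  planar_isWeak.2.2.1

end WholeSpaceWeak

/-! ## §C Transplanting the planar flow to the flat torus `T²` -/

section TorusTwo

open Literature.Analysis.FunctionSpaces.Torus (proj repr lift liftAt unitCube stLift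
  IsSpaceTimeTest IsSpaceTimeTestIoo IsDivFreeTest IsSmooth IsContDiff
  measurableSet_unitCube measurable_proj measurable_repr continuous_proj lift_apply fderiv_lift
  repr_proj_of_mem_unitCube_holds integral_eq_integral_lift_holds isDivFree_iff_trace_fderiv_lift
  fderiv_apply_eq_sum_partialDeriv)

/-- The flat two-torus, local notation. -/
local notation "𝕋²" => UnitAddTorus (Fin 2)

/-- **The planar flow on `T²`**: `U₂(t, y) = u(t, repr y)` (the disc `B` lies inside the
fundamental square, so this is the periodisation of `u(t)`). [folklore] -/
def U₂ : ℝ → 𝕋² → E² := fun t y => uW t (repr y)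

/-- Unfolding `U₂`. [folklore] -/
theorem U₂_apply (t : ℝ) (y : 𝕋²) : U₂ t y = uW t (repr y) := rfl

/-- `‖U₂‖ ≤ 2` everywhere. [folklore] -/
theorem norm_U₂_le (t : ℝ) (y : 𝕋²) : ‖U₂ t y‖ ≤ 2 := norm_uW_le _ _

/-- The disc `B = B(c, 1/8)` lies in the fundamental square `[0,1)²`. [folklore] -/
theorem disc_subset_unitCube : disc ⊆ unitCube (Fin 2) := by
  intro Y hY i
  have h1 : ‖(Y - ctr) i‖ ≤ ‖Y - ctr‖ := PiLp.norm_apply_le (Y - ctr) i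
  have h2 : ‖Y - ctr‖ < 1 / 8 := by rwa [← dist_eq_norm]
  have h3 : |Y i - 1 / 2| < 1 / 8 := by
    have := h1.trans_lt h2
    simpa [Real.norm_eq_abs] using this
  rw [abs_lt] at h3
  constructor <;> linarith [h3.1, h3.2]

/-- On the fundamental square `U₂(t) ∘ proj = u(t)`. [folklore] -/
theorem U₂_proj {Y : E²} (hY : Y ∈ unitCube (Fin 2)) (t : ℝ) : U₂ t (proj Y) = uW t Y := by
  rw [U₂_apply, repr_proj_of_mem_unitCube_holds hY]

/-- `U₂(t) = 0` for `t ∉ (1/4, 3/4)`. [folklore] -/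
theorem U₂_eq_zero_of_time {t : ℝ} (ht : t ∉ Ioo (1 / 4 : ℝ) (3 / 4)) : U₂ t = 0 := by
  funext y
  rw [U₂_apply, uW_eq_zero_of_time ht, Pi.zero_apply, Pi.zero_apply]

/-- Joint measurability of `U₂`. [folklore] -/
theorem measurable_uncurry_U₂ : Measurable (uncurry U₂) := by
  have h : uncurry U₂ = uncurry uW ∘ fun p : ℝ × 𝕋² => (p.1, repr p.2) := by
    funext p; rfl
  rw [h]
  exact measurable_uncurry_uW.comp (measurable_fst.prodMk (measurable_repr.comp measurable_snd))

/-- Joint measurability of the space–time lift of `U₂`. [folklore] -/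
theorem measurable_stLift_U₂ : Measurable (stLift U₂) := by
  have h : stLift U₂ = uncurry U₂ ∘ fun p : ℝ × E² => (p.1, proj p.2) := by
    funext p; rfl
  rw [h]
  exact measurable_uncurry_U₂.comp (measurable_fst.prodMk (measurable_proj.comp measurable_snd))

/-- Every time slice of `U₂` is measurable. [folklore] -/
theorem measurable_U₂ (t : ℝ) : Measurable (U₂ t) :=
  measurable_uncurry_U₂.comp (measurable_const.prodMk measurable_id)

/-- Every slice of `U₂` is in `L²(T²)` (bounded on a probability space). [folklore] -/
theorem memLp_U₂ (t : ℝ) : MemLp (U₂ t) 2 volume :=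
  MemLp.of_bound (measurable_U₂ t).aestronglyMeasurable 2 (ae_of_all _ (norm_U₂_le t))

/-! ### Cut-offs -/

/-- The spatial cut-off `η`: a smooth bump around `c`, equal to `1` on `B̄(c, 3/16) ⊃ B` and
supported in `B(c, 1/4)`. [folklore] -/
def ηsp : ContDiffBump (ctr : E²) := ⟨3 / 16, 1 / 4, by norm_num, by norm_num⟩

/-- The temporal cut-off `χ`: a smooth bump around `1/2`, equal to `1` on `[1/4, 3/4]` and
supported in `(1/8, 7/8)`. [folklore] -/
def χt : ContDiffBump (1 / 2 : ℝ) := ⟨1 / 4, 3 / 8, by norm_num, by norm_num⟩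

/-- `η ≡ 1` near every point of the disc `B`. [folklore] -/
theorem ηsp_eventuallyEq_one {Y : E²} (hY : Y ∈ disc) : (ηsp : E² → ℝ) =ᶠ[𝓝 Y] 1 :=
  ηsp.eventuallyEq_one_of_mem_ball (by
    have h : dist Y ctr < 1 / 8 := hY
    show dist Y ctr < 3 / 16
    linarith)

/-- `η = 1` on the disc `B`. [folklore] -/
theorem ηsp_eq_one {Y : E²} (hY : Y ∈ disc) : ηsp Y = 1 := by
  have h := (ηsp_eventuallyEq_one hY).self_of_nhds
  simpa using h

/-- `η = 0` off `B̄(c, 1/4)`. [folklore] -/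
theorem ηsp_eq_zero {Y : E²} (hY : Y ∉ closedBall ctr (1 / 4)) : ηsp Y = 0 :=
  ηsp.zero_of_le_dist (by
    have h : ¬dist Y ctr ≤ 1 / 4 := hY
    show (1 : ℝ) / 4 ≤ dist Y ctr
    linarith [not_le.1 h])

/-- `χ ≡ 1` near every `t ∈ (1/4, 3/4)`. [folklore] -/
theorem χt_eventuallyEq_one {t : ℝ} (ht : t ∈ Ioo (1 / 4 : ℝ) (3 / 4)) : (χt : ℝ → ℝ) =ᶠ[𝓝 t] 1 :=
  χt.eventuallyEq_one_of_mem_ball (by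
    show dist t (1 / 2) < 1 / 4
    rw [Real.dist_eq, abs_lt]
    constructor <;> linarith [ht.1, ht.2])

/-- `χ = 1` on `(1/4, 3/4)`. [folklore] -/
theorem χt_eq_one {t : ℝ} (ht : t ∈ Ioo (1 / 4 : ℝ) (3 / 4)) : χt t = 1 := by
  have h := (χt_eventuallyEq_one ht).self_of_nhds
  simpa using h

/-- `χ = 0` off `[1/8, 7/8]`. [folklore] -/
theorem χt_eq_zero {t : ℝ} (ht : t ∉ Icc (1 / 8 : ℝ) (7 / 8)) : χt t = 0 :=
  χt.zero_of_le_dist (by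
    show (3 : ℝ) / 8 ≤ dist t (1 / 2)
    rw [Real.dist_eq]
    by_contra h
    rw [not_le, abs_lt] at h
    exact ht ⟨by linarith [h.1], by linarith [h.2]⟩)

/-! ### Weak incompressibility on the torus -/

/-- The gradient of the periodic lift: `∇(θ ∘ proj)(Y) = ∇_T θ (proj Y)`. [folklore] -/
theorem gradient_lift (θ : 𝕋² → ℝ) (Y : E²) :
    gradient (lift θ) Y = FunctionSpaces.Torus.gradient θ (proj Y) := by
  refine ext_inner_right ℝ fun w => ?_
  rw [FunctionSpaces.Torus.inner_gradient_left, ← fderiv_lift,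
    ← InnerProductSpace.toDual_apply_apply (𝕜 := ℝ), toDual_gradient]

/-- Gradients of functions agreeing near a point agree at the point. [folklore] -/
theorem gradient_congr_of_eventuallyEq {f g : E² → ℝ} {Y : E²} (h : f =ᶠ[𝓝 Y] g) :
    gradient f Y = gradient g Y := by
  unfold gradient
  rw [h.fderiv_eq]

/-- **Weak incompressibility transplants to the torus.** If `u(t)` is weakly divergence free
on `ℝ²` then `U₂(t)` is weakly divergence free on `T²`: a smooth periodic `θ` is localized to
`θ' = η · (θ ∘ proj) ∈ C_c^∞(ℝ²)`, whose gradient agrees with that of `θ ∘ proj` on `B`, and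
the torus integral is the integral over the fundamental square. [folklore] -/
theorem isWeaklyDivFree_U₂ {t : ℝ} (ht : IsWeaklyDivFree (uW t)) :
    FunctionSpaces.Torus.IsWeaklyDivFree (U₂ t) := by
  intro θ hθ
  set θ' : E² → ℝ := fun Y => ηsp Y * lift θ Y with hθ'
  have hθ't : FunctionSpaces.IsTestFunctionOn (⊤ : Opens E²) θ' :=
    ⟨ηsp.contDiff.mul hθ, ηsp.hasCompactSupport.mul_right, by simp⟩
  have hgrad : ∀ {Y : E²}, Y ∈ disc →
      gradient θ' Y = FunctionSpaces.Torus.gradient θ (proj Y) := by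
    intro Y hY
    rw [← gradient_lift]
    refine gradient_congr_of_eventuallyEq ?_
    filter_upwards [ηsp_eventuallyEq_one hY] with Y' hY'
    simp [hθ', hY']
  calc ∫ y, ⟪U₂ t y, FunctionSpaces.Torus.gradient θ y⟫
      = ∫ Y in unitCube (Fin 2),
          lift (fun y => ⟪U₂ t y, FunctionSpaces.Torus.gradient θ y⟫) Y :=
        integral_eq_integral_lift_holds _
    _ = ∫ Y in unitCube (Fin 2), ⟪uW t Y, gradient θ' Y⟫ := by
        refine setIntegral_congr_fun measurableSet_unitCube fun Y hY => ?_
        rw [lift_apply, U₂_proj hY]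
        by_cases hYd : Y ∈ disc
        · rw [hgrad hYd]
        · rw [uW_eq_zero_of_space hYd, inner_zero_left, inner_zero_left]
    _ = ∫ Y, ⟪uW t Y, gradient θ' Y⟫ := by
        refine setIntegral_eq_integral_of_forall_compl_eq_zero fun Y hY => ?_
        rw [uW_eq_zero_of_space fun h => hY (disc_subset_unitCube h), inner_zero_left]
    _ = 0 := ht θ' hθ't

/-- `U₂(t)` is weakly divergence free for a.e. `t ∈ (0,1)`. [folklore] -/
theorem ae_isWeaklyDivFree_U₂ :
    ∀ᵐ t ∂(volume.restrict (Ioo (0 : ℝ) 1)), FunctionSpaces.Torus.IsWeaklyDivFree (U₂ t) := by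
  filter_upwards [ae_isWeaklyDivFree_uW] with t ht
  exact isWeaklyDivFree_U₂ ht

/-! ### The weak Euler identity on the torus -/

variable {Ψ : ℝ → 𝕋² → E²}

/-- The localized whole-space test field `ψ'(t, Y) = χ(t) η(Y) Ψ(t, proj Y)`. [folklore] -/
def locTest (Ψ : ℝ → 𝕋² → E²) : ℝ → E² → E² := fun t Y => (χt t * ηsp Y) • Ψ t (proj Y)

/-- Unfolding the localized test field. [folklore] -/
theorem locTest_apply (Ψ : ℝ → 𝕋² → E²) (t : ℝ) (Y : E²) :
    locTest Ψ t Y = (χt t * ηsp Y) • Ψ t (proj Y) := rfl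

/-- The localized test field, uncurried, in terms of the space–time lift of `Ψ`. [folklore] -/
theorem uncurry_locTest (Ψ : ℝ → 𝕋² → E²) :
    uncurry (locTest Ψ) = fun z : ℝ × E² => (χt z.1 * ηsp z.2) • stLift Ψ z := rfl

/-- The localized field is a space–time test field on the slab `(0,1) × ℝ²`. [folklore] -/
theorem locTest_isSpaceTimeTestOn (hΨ : IsSpaceTimeTest 1 Ψ) :
    IsSpaceTimeTestOn (slab E² (Ioo 0 1) isOpen_Ioo) (locTest Ψ) := by
  -- smoothness (at the exponent of `hΨ.1`; `uncurry (locTest Ψ)` unfolds to this product)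
  have hs := ((χt.contDiff.comp contDiff_fst).mul (ηsp.contDiff.comp contDiff_snd)).smul hΨ.1
  set K : Set (ℝ × E²) := Icc (1 / 8 : ℝ) (7 / 8) ×ˢ closedBall ctr (1 / 4) with hK
  have hKc : IsCompact K := isCompact_Icc.prod (isCompact_closedBall _ _)
  have hzero : ∀ z, z ∉ K → uncurry (locTest Ψ) z = 0 := by
    intro z hz
    rw [uncurry_locTest]
    by_cases h1 : z.1 ∈ Icc (1 / 8 : ℝ) (7 / 8)
    · have h2 : z.2 ∉ closedBall ctr (1 / 4) := fun h2 => hz (mem_prod.2 ⟨h1, h2⟩)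
      simp [ηsp_eq_zero h2]
    · simp [χt_eq_zero h1]
  have hsupp : HasCompactSupport (uncurry (locTest Ψ)) := HasCompactSupport.intro hKc hzero
  have htsupp : tsupport (uncurry (locTest Ψ)) ⊆ K :=
    closure_minimal (fun z hz => by_contra fun h => hz (hzero z h)) hKc.isClosed
  refine ⟨hs, hsupp, htsupp.trans ?_⟩
  rintro ⟨t, Y⟩ ⟨ht, -⟩
  simp only [coe_slab, mem_prod, mem_univ, and_true, mem_Ioo]
  exact ⟨by linarith [ht.1], by linarith [ht.2]⟩

/-- **The torus-side weak integrand** of `U₂` against `Ψ`, written on `ℝ × ℝ²`: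
`F(t, Y) = ⟪u, ∂ₜΨ ∘ proj⟫ + ⟪u, (DΨ ∘ proj) u⟫`. [folklore] -/
def Fint (Ψ : ℝ → 𝕋² → E²) (t : ℝ) (Y : E²) : ℝ :=
  ⟪uW t Y, FunctionSpaces.Torus.timeDeriv Ψ t (proj Y)⟫ +
    ⟪uW t Y, FunctionSpaces.Torus.fderiv (Ψ t) (proj Y) (uW t Y)⟫

/-- `F` vanishes off the cylinder. [folklore] -/
theorem Fint_eq_zero_of_not_mem {z : ℝ × E²} (hz : z ∉ cyl) : Fint Ψ z.1 z.2 = 0 := by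
  have hu : uW z.1 z.2 = 0 := indicator_of_notMem hz _
  simp [Fint, hu]

/-- **Pointwise identification of the weak integrands.** Against the localized test field the
pressure-explicit whole-space Euler integrand of `(u, p)` is the torus-side weak integrand `F`:
near every point of the cylinder the localized field *is* the lift of `Ψ` (both cut-offs are
`≡ 1` there), so its time derivative, spatial derivative and divergence are those of `Ψ`, and
`div Ψ = 0` kills the pressure; off the cylinder both sides vanish. [folklore] -/
theorem weakIntegrand_locTest_eq (hΨ : IsSpaceTimeTest 1 Ψ) (hdiv : IsDivFreeTest Ψ)
    (z : ℝ × E²) :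
    ⟪uW z.1 z.2, timeDeriv (locTest Ψ) z.1 z.2⟫ +
        ⟪uW z.1 z.2, convect (uW z.1) (locTest Ψ z.1) z.2⟫ +
        0 * ⟪uW z.1 z.2, Δ (locTest Ψ z.1) z.2⟫ +
        pW z.1 z.2 * VectorCalculus.divergence (locTest Ψ z.1) z.2 +
        ⟪(0 : ℝ → E² → E²) z.1 z.2, locTest Ψ z.1 z.2⟫ = Fint Ψ z.1 z.2 := by
  by_cases hz : z ∈ cyl
  · obtain ⟨ht, hY⟩ := mem_cyl.1 hz
    have hslice : locTest Ψ z.1 =ᶠ[𝓝 z.2] lift (Ψ z.1) := by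
      filter_upwards [ηsp_eventuallyEq_one hY] with Y' hY'
      simp only [Pi.one_apply] at hY'
      simp [locTest_apply, χt_eq_one ht, hY', lift_apply]
    have htime : (fun s => locTest Ψ s z.2) =ᶠ[𝓝 z.1] fun s => Ψ s (proj z.2) := by
      filter_upwards [χt_eventuallyEq_one ht] with s hs
      simp only [Pi.one_apply] at hs
      simp [locTest_apply, hs, ηsp_eq_one hY]
    have h1 : timeDeriv (locTest Ψ) z.1 z.2 = FunctionSpaces.Torus.timeDeriv Ψ z.1 (proj z.2) := by
      rw [timeDeriv_apply, htime.deriv_eq]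
      rfl
    have h2 : fderiv ℝ (locTest Ψ z.1) z.2 = FunctionSpaces.Torus.fderiv (Ψ z.1) (proj z.2) := by
      rw [hslice.fderiv_eq, fderiv_lift]
    have hC1 : IsContDiff 1 (Ψ z.1) := (hΨ.isSmooth_slice z.1).isContDiff (by simp)
    have h3 : VectorCalculus.divergence (locTest Ψ z.1) z.2 = 0 := by
      rw [VectorCalculus.divergence, hslice.fderiv_eq]
      exact (isDivFree_iff_trace_fderiv_lift hC1).1 (hdiv z.1) z.2
    rw [convect_apply, h1, h2, h3, Fint]
    simp
  · have hu : uW z.1 z.2 = 0 := indicator_of_notMem hz _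
    have hp : pW z.1 z.2 = 0 := indicator_of_notMem hz _
    rw [Fint_eq_zero_of_not_mem hz]
    simp [hu, hp]

/-- **Slices: the torus pairing is the whole-space pairing.** For every `t`,
`∫_{ℝ²} F(t, Y) dY = ∫_{T²} (⟪U₂, ∂ₜΨ⟫ + ⟪U₂, (U₂·∇)Ψ⟫)(t, y) dy` (integral over the torus =
integral of the lift over the fundamental square, and `F(t, ·)` vanishes off `B ⊂ [0,1)²`).
[folklore] -/
theorem integral_Fint_slice (t : ℝ) :
    ∫ Y, Fint Ψ t Y = ∫ y, (⟪U₂ t y, FunctionSpaces.Torus.timeDeriv Ψ t y⟫ +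
      ⟪U₂ t y, FunctionSpaces.Torus.convect (U₂ t) (Ψ t) y⟫) := by
  symm
  calc ∫ y, (⟪U₂ t y, FunctionSpaces.Torus.timeDeriv Ψ t y⟫ +
        ⟪U₂ t y, FunctionSpaces.Torus.convect (U₂ t) (Ψ t) y⟫)
      = ∫ Y in unitCube (Fin 2), lift (fun y => ⟪U₂ t y, FunctionSpaces.Torus.timeDeriv Ψ t y⟫ +
          ⟪U₂ t y, FunctionSpaces.Torus.convect (U₂ t) (Ψ t) y⟫) Y :=
        integral_eq_integral_lift_holds _
    _ = ∫ Y in unitCube (Fin 2), Fint Ψ t Y := by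
        refine setIntegral_congr_fun measurableSet_unitCube fun Y hY => ?_
        rw [lift_apply, FunctionSpaces.Torus.convect, U₂_proj hY, Fint]
    _ = ∫ Y, Fint Ψ t Y := by
        refine setIntegral_eq_integral_of_forall_compl_eq_zero fun Y hY => ?_
        have hu : uW t Y = 0 := uW_eq_zero_of_space fun h => hY (disc_subset_unitCube h)
        simp [Fint, hu]

/-- `F` is a.e. strongly measurable on `ℝ × ℝ²`. [folklore] -/
theorem aestronglyMeasurable_Fint (hΨ : IsSpaceTimeTest 1 Ψ) (μ : Measure (ℝ × E²)) :
    AEStronglyMeasurable (uncurry (Fint Ψ)) μ := by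
  have hC1 : ∀ t, IsContDiff 1 (Ψ t) := fun t => (hΨ.isSmooth_slice t).isContDiff (by simp)
  have hu : AEStronglyMeasurable (uncurry uW) μ := measurable_uncurry_uW.aestronglyMeasurable
  have hTD : Continuous fun z : ℝ × E² => FunctionSpaces.Torus.timeDeriv Ψ z.1 (proj z.2) :=
    hΨ.timeDeriv.1.continuous
  have hPD : ∀ j : Fin 2, Continuous fun z : ℝ × E² =>
      FunctionSpaces.Torus.partialDeriv j (Ψ z.1) (proj z.2) := fun j =>
    (hΨ.continuous_uncurry_lineDeriv (EuclideanSpace.single j 1)).comp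
      (continuous_fst.prodMk (continuous_proj.comp continuous_snd))
  have hrepr : uncurry (Fint Ψ) = fun z : ℝ × E² =>
      ⟪uncurry uW z, FunctionSpaces.Torus.timeDeriv Ψ z.1 (proj z.2)⟫ +
        ⟪uncurry uW z,
          ∑ j, uncurry uW z j • FunctionSpaces.Torus.partialDeriv j (Ψ z.1) (proj z.2)⟫ := by
    funext z
    simp only [uncurry, Fint, fderiv_apply_eq_sum_partialDeriv (hC1 z.1)]
  rw [hrepr]
  refine (hu.inner hTD.aestronglyMeasurable).add (hu.inner ?_)
  refine Finset.aestronglyMeasurable_fun_sum (Finset.univ : Finset (Fin 2)) fun j _ => ?_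
  exact ((EuclideanSpace.proj j).continuous.comp_aestronglyMeasurable hu).smul
    (hPD j).aestronglyMeasurable

/-- `F` is bounded (by a constant depending on `Ψ`). [folklore] -/
theorem exists_bound_Fint (hΨ : IsSpaceTimeTest 1 Ψ) :
    ∃ C : ℝ, ∀ z ∈ cyl, ‖uncurry (Fint Ψ) z‖ ≤ C := by
  have hC1 : ∀ t, IsContDiff 1 (Ψ t) := fun t => (hΨ.isSmooth_slice t).isContDiff (by simp)
  obtain ⟨M₁, hM₁⟩ := hΨ.exists_bound_timeDeriv (isCompact_Icc (a := (0 : ℝ)) (b := 1))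
  obtain ⟨M₂, -, hM₂⟩ := hΨ.exists_bound_sum_partialDeriv (isCompact_Icc (a := (0 : ℝ)) (b := 1))
  refine ⟨2 * M₁ + 4 * M₂, fun z hz => ?_⟩
  obtain ⟨ht, -⟩ := mem_cyl.1 hz
  have htI : z.1 ∈ Icc (0 : ℝ) 1 := ⟨by linarith [ht.1], by linarith [ht.2]⟩
  have ha : ‖uW z.1 z.2‖ ≤ 2 := norm_uW_le _ _
  have h1 : ‖⟪uW z.1 z.2, FunctionSpaces.Torus.timeDeriv Ψ z.1 (proj z.2)⟫‖ ≤ 2 * M₁ :=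
    (norm_inner_le_norm _ _).trans
      (mul_le_mul ha (hM₁ _ htI _) (norm_nonneg _) zero_le_two)
  have h2 : ‖⟪uW z.1 z.2, FunctionSpaces.Torus.fderiv (Ψ z.1) (proj z.2) (uW z.1 z.2)⟫‖ ≤
      4 * M₂ := by
    rw [fderiv_apply_eq_sum_partialDeriv (hC1 z.1)]
    calc ‖⟪uW z.1 z.2, ∑ j, uW z.1 z.2 j • FunctionSpaces.Torus.partialDeriv j (Ψ z.1) (proj z.2)⟫‖
        ≤ ‖uW z.1 z.2‖ *
            ‖∑ j, uW z.1 z.2 j • FunctionSpaces.Torus.partialDeriv j (Ψ z.1) (proj z.2)‖ :=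
          norm_inner_le_norm _ _
      _ ≤ ‖uW z.1 z.2‖ *
            ∑ j, ‖uW z.1 z.2‖ * ‖FunctionSpaces.Torus.partialDeriv j (Ψ z.1) (proj z.2)‖ := by
          refine mul_le_mul_of_nonneg_left ((norm_sum_le _ _).trans
            (Finset.sum_le_sum fun j _ => ?_)) (norm_nonneg _)
          rw [norm_smul]
          exact mul_le_mul_of_nonneg_right (PiLp.norm_apply_le (uW z.1 z.2) j) (norm_nonneg _)
      _ = ‖uW z.1 z.2‖ ^ 2 * ∑ j, ‖FunctionSpaces.Torus.partialDeriv j (Ψ z.1) (proj z.2)‖ := by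
          rw [← Finset.mul_sum]
          ring
      _ ≤ 4 * M₂ :=
          mul_le_mul (by nlinarith [norm_nonneg (uW z.1 z.2)]) (hM₂ _ htI _)
            (Finset.sum_nonneg fun j _ => norm_nonneg _) (by norm_num)
  calc ‖uncurry (Fint Ψ) z‖ ≤ ‖⟪uW z.1 z.2, FunctionSpaces.Torus.timeDeriv Ψ z.1 (proj z.2)⟫‖ +
        ‖⟪uW z.1 z.2, FunctionSpaces.Torus.fderiv (Ψ z.1) (proj z.2) (uW z.1 z.2)⟫‖ :=
        norm_add_le _ _
    _ ≤ 2 * M₁ + 4 * M₂ := add_le_add h1 h2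

/-- `F` is integrable for `dt|_(0,1) ⊗ dY` (bounded, supported in the cylinder). [folklore] -/
theorem integrable_Fint (hΨ : IsSpaceTimeTest 1 Ψ) :
    Integrable (uncurry (Fint Ψ))
      ((volume.restrict (Ioo (0 : ℝ) 1)).prod (volume : Measure E²)) := by
  rw [← volume_restrict_slab_eq]
  have hsupp : support (uncurry (Fint Ψ)) ⊆ cyl := fun z hz => by
    by_contra h
    exact hz (Fint_eq_zero_of_not_mem h)
  obtain ⟨C, hC⟩ := exists_bound_Fint hΨ
  have hint : IntegrableOn (uncurry (Fint Ψ)) cyl volume :=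
    IntegrableOn.of_bound volume_cyl_lt_top (aestronglyMeasurable_Fint hΨ _) C
      ((ae_restrict_iff' measurableSet_cyl).2 (ae_of_all _ hC))
  exact ((integrableOn_iff_integrable_of_support_subset hsupp).1 hint).integrableOn

/-- **The weak Euler identity of `U₂` on `T² × (0,1)`** against every divergence-free
space–time test field `Ψ` on `T²` (not necessarily vanishing near `t = 0`: `U₂(t) = 0` for
`t ≤ 1/4`): the distributional identity of `(u, p)` tested with the localized field `ψ'`, read
through `weakIntegrand_locTest_eq`, Fubini, and `integral_Fint_slice`. [folklore] -/
theorem U₂_weakIdentity (hΨ : IsSpaceTimeTest 1 Ψ) (hdiv : IsDivFreeTest Ψ) :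
    ∫ t in Ioo (0 : ℝ) 1, ∫ y, (⟪U₂ t y, FunctionSpaces.Torus.timeDeriv Ψ t y⟫ +
        ⟪U₂ t y, FunctionSpaces.Torus.convect (U₂ t) (Ψ t) y⟫ +
        (0 : ℝ) * ⟪U₂ t y, FunctionSpaces.Torus.laplacian (Ψ t) y⟫) = 0 := by
  have hG := planar_isDistributional.2.2.2.2 (locTest Ψ) (locTest_isSpaceTimeTestOn hΨ)
  have hG' : ∫ z in Ioo (0 : ℝ) 1 ×ˢ (univ : Set E²), uncurry (Fint Ψ) z = 0 :=
    (integral_congr_ae (ae_of_all _ fun z => (weakIntegrand_locTest_eq hΨ hdiv z).symm)).trans hG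
  rw [volume_restrict_slab_eq, integral_prod _ (integrable_Fint hΨ)] at hG'
  refine Eq.trans ?_ hG'
  refine setIntegral_congr_fun measurableSet_Ioo fun t _ => ?_
  rw [show (∫ Y, uncurry (Fint Ψ) (t, Y)) = ∫ Y, Fint Ψ t Y from rfl, integral_Fint_slice t]
  refine integral_congr_ae (ae_of_all _ fun y => ?_)
  simp only [zero_mul, add_zero]

/-- **The planar flow is a weak Euler solution on `T² × (0,1)`** in the accepted sense
`Torus.IsWeakNSSolutionOn` (De Lellis–Székelyhidi 2009, §1). [cite: LellisSzekelyhidi2009, §1] -/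
theorem planarTorus_isWeak : FunctionSpaces.Torus.IsWeakNSSolutionOn 1 0 U₂ := by
  refine ⟨measurable_stLift_U₂.aestronglyMeasurable, ?_, ae_isWeaklyDivFree_U₂,
    fun Ψ hΨ hdiv => ?_⟩
  · calc ∫⁻ t in Ioo (0 : ℝ) 1, ∫⁻ y, ‖U₂ t y‖ₑ ^ 2
        ≤ ∫⁻ _ in Ioo (0 : ℝ) 1, (4 : ℝ≥0∞) := by
          refine lintegral_mono fun t => ?_
          calc ∫⁻ y, ‖U₂ t y‖ₑ ^ 2 ≤ ∫⁻ _ : 𝕋², (4 : ℝ≥0∞) :=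
                lintegral_mono fun y => enorm_sq_le_four (norm_U₂_le t y)
            _ = 4 := by simp
      _ < ∞ := by simp
  · have h := U₂_weakIdentity hΨ.1 hdiv
    simpa using h

end TorusTwo

/-! ## §D The `2½`-dimensional lift to `T³` -/

section TorusThree

open Literature.Analysis.FunctionSpaces.Torus (proj repr lift unitCube stLift twoHalf planarProj
  axisAvg IsSpaceTimeTest IsSpaceTimeTestIoo IsDivFreeTest IsSmooth IsContDiff
  measurableSet_unitCube lift_apply integral_eq_integral_lift_holds timeDeriv_axisAvg
  setIntegral_weakIntegrand_eq_add integrable_inner_timeDeriv_slice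
  integrableOn_integral_inner_timeDeriv integrable_inner_convect_slice integral_comp_planarProj)

/-- The flat two-torus, local notation. -/
local notation "𝕋²" => UnitAddTorus (Fin 2)
/-- The flat three-torus, local notation. -/
local notation "𝕋³" => UnitAddTorus (Fin 3)
/-- Euclidean `ℝ³`, local notation. -/
local notation "E³" => EuclideanSpace ℝ (Fin 3)

/-- **The dissipative flow on `T³`**: the `2½`-dimensional lift `U₃(t) = (U₂(t), 0) ∘ π` of the
planar flow (Bardos–Titi–Wiedemann 2012, proof of Cor. 2, with zero vertical component).
[folklore] -/
def U₃ : ℝ → 𝕋³ → E³ := fun t => twoHalf (U₂ t) 0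

/-- Unfolding `U₃`. [folklore] -/
theorem U₃_apply (t : ℝ) : U₃ t = twoHalf (U₂ t) 0 := rfl

/-- `‖U₃(t, x)‖ = ‖U₂(t, π x)‖`. [folklore] -/
theorem norm_U₃ (t : ℝ) (x : 𝕋³) : ‖U₃ t x‖ = ‖U₂ t (planarProj x)‖ :=
  Torus.norm_twoHalf_zero_right _ _

/-- `‖U₃‖ ≤ 2` everywhere. [folklore] -/
theorem norm_U₃_le (t : ℝ) (x : 𝕋³) : ‖U₃ t x‖ ≤ 2 := by
  rw [norm_U₃]
  exact norm_U₂_le _ _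

/-- Every time slice of `U₃` is in `L²(T³)`. [folklore] -/
theorem memLp_U₃ (t : ℝ) : MemLp (U₃ t) 2 volume :=
  Torus.memLp_twoHalf one_le_two (memLp_U₂ t) (memLp_const 0)

/-- `∫_{T²} ‖U₂(t)‖² ≤ 4`. [folklore] -/
theorem integral_norm_sq_U₂_le (t : ℝ) : ∫ y, ‖U₂ t y‖ ^ 2 ≤ 4 := by
  calc ∫ y, ‖U₂ t y‖ ^ 2 ≤ ∫ _ : 𝕋², (4 : ℝ) :=
        integral_mono ((memLp_U₂ t).integrable_norm_pow two_ne_zero) (integrable_const _)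
          fun y => by nlinarith [norm_U₂_le t y, norm_nonneg (U₂ t y)]
    _ = 4 := by simp

/-- `∫_{T³} ‖U₃(t)‖² ≤ 4`. [folklore] -/
theorem integral_norm_sq_U₃_le (t : ℝ) : ∫ x, ‖U₃ t x‖ ^ 2 ≤ 4 := by
  calc ∫ x, ‖U₃ t x‖ ^ 2 ≤ ∫ _ : 𝕋³, (4 : ℝ) :=
        integral_mono ((memLp_U₃ t).integrable_norm_pow two_ne_zero) (integrable_const _)
          fun x => by nlinarith [norm_U₃_le t x, norm_nonneg (U₃ t x)]
    _ = 4 := by simp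

/-- Joint measurability of `U₂` for the product measure `dt|_(0,1) ⊗ dy`. [folklore] -/
theorem aestronglyMeasurable_uncurry_U₂ :
    AEStronglyMeasurable (uncurry U₂)
      ((volume.restrict (Ioo (0 : ℝ) 1)).prod (volume : Measure 𝕋²)) :=
  measurable_uncurry_U₂.aestronglyMeasurable

/-- Joint measurability of `U₃` for the product measure `dt|_(0,1) ⊗ dx`. [folklore] -/
theorem aestronglyMeasurable_uncurry_U₃ :
    AEStronglyMeasurable (uncurry U₃)
      ((volume.restrict (Ioo (0 : ℝ) 1)).prod (volume : Measure 𝕋³)) :=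
  Torus.aestronglyMeasurable_uncurry_twoHalf (w := fun _ _ => (0 : ℝ))
    aestronglyMeasurable_uncurry_U₂ aestronglyMeasurable_const

/-- **The weak Euler identity of the lift** (Bardos–Titi–Wiedemann 2012, proof of Cor. 2, with
`w = 0`): pairing the `x₃`-independent field `U₃` with a divergence-free test field `ψ` on `T³`
only sees the `x₃`-average of `ψ`, whose planar part `Ψ` is a divergence-free planar test field;
the identity reduces to `U₂_weakIdentity` for `Ψ`. [cite: BardosTitiWiedemann2012, Cor. 2, proof] -/
theorem U₃_weakIdentity {ψ : ℝ → 𝕋³ → E³} (hψ : IsSpaceTimeTest 1 ψ) (hdiv : IsDivFreeTest ψ) :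
    ∫ t in Ioo (0 : ℝ) 1, ∫ x, (⟪U₃ t x, FunctionSpaces.Torus.timeDeriv ψ t x⟫ +
        ⟪U₃ t x, FunctionSpaces.Torus.convect (U₃ t) (ψ t) x⟫ +
        (0 : ℝ) * ⟪U₃ t x, FunctionSpaces.Torus.laplacian (ψ t) x⟫) = 0 := by
  have hΨ : IsSpaceTimeTest 1 (Torus.planarTest ψ) := Torus.isSpaceTimeTest_planarTest hψ
  have hΨ₃ : IsSpaceTimeTest 1 (Torus.verticalTest ψ) := Torus.isSpaceTimeTest_verticalTest hψ
  have hΨdiv : IsDivFreeTest (Torus.planarTest ψ) := Torus.isDivFreeTest_planarTest hψ hdiv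
  have hum := aestronglyMeasurable_uncurry_U₂
  have hVm := aestronglyMeasurable_uncurry_U₃
  have hu2 : ∀ t ∈ Ioo (0 : ℝ) 1, MemLp (U₂ t) 2 volume := fun t _ => memLp_U₂ t
  have hV2 : ∀ t ∈ Ioo (0 : ℝ) 1, MemLp (U₃ t) 2 volume := fun t _ => memLp_U₃ t
  have hCu : ∀ t ∈ Ioo (0 : ℝ) 1, ∫ y, ‖U₂ t y‖ ^ 2 ≤ 4 := fun t _ => integral_norm_sq_U₂_le t
  have hCV : ∀ t ∈ Ioo (0 : ℝ) 1, ∫ x, ‖U₃ t x‖ ^ 2 ≤ 4 := fun t _ => integral_norm_sq_U₃_le t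
  have hinv : ∀ t (s : UnitAddCircle) (x : 𝕋³), U₃ t (x + Pi.single (Fin.last 2) s) = U₃ t x :=
    fun t => Torus.twoHalf_add_single (U₂ t) 0
  -- Step 1: split the three-dimensional integrand
  rw [setIntegral_weakIntegrand_eq_add hVm hV2 hCV hψ]
  -- Step 2: the time-derivative term
  have hA : ∀ t ∈ Ioo (0 : ℝ) 1,
      ∫ x, ⟪U₃ t x, FunctionSpaces.Torus.timeDeriv ψ t x⟫ =
        ∫ y, ⟪U₂ t y, FunctionSpaces.Torus.timeDeriv (Torus.planarTest ψ) t y⟫ := by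
    intro t ht
    have h1 := Torus.integral_inner_eq_axisAvg_of_isSmooth (hV2 t ht) (hinv t)
      (hψ.timeDeriv.isSmooth_slice t)
    have h2 : axisAvg (Fin.last 2) (FunctionSpaces.Torus.timeDeriv ψ t) =
        FunctionSpaces.Torus.timeDeriv (Torus.axisAvg₃ ψ) t := by
      funext x
      exact (timeDeriv_axisAvg hψ.1 (Fin.last 2) t x).symm
    rw [h1, h2, Torus.timeDeriv_axisAvg₃_eq_twoHalf hψ t, U₃_apply,
      Torus.integral_inner_twoHalf_eq_add (integrable_inner_timeDeriv_slice hΨ (memLp_U₂ t))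
        (by simp)]
    simp
  have hAint : ∫ t in Ioo (0 : ℝ) 1, ∫ x, ⟪U₃ t x, FunctionSpaces.Torus.timeDeriv ψ t x⟫ =
      ∫ t in Ioo (0 : ℝ) 1,
        ∫ y, ⟪U₂ t y, FunctionSpaces.Torus.timeDeriv (Torus.planarTest ψ) t y⟫ :=
    setIntegral_congr_fun measurableSet_Ioo hA
  -- Step 3: the convective term
  have hB : ∀ t ∈ Ioo (0 : ℝ) 1,
      ∫ x, ⟪U₃ t x, FunctionSpaces.Torus.convect (U₃ t) (ψ t) x⟫ =
        ∫ y, ⟪U₂ t y, FunctionSpaces.Torus.convect (U₂ t) (Torus.planarTest ψ t) y⟫ := by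
    intro t ht
    rw [Torus.integral_inner_convect_eq_axisAvg (hV2 t ht) (hinv t) (hψ.isSmooth_slice t),
      show axisAvg (Fin.last 2) (ψ t) = Torus.axisAvg₃ ψ t from rfl, Torus.axisAvg₃_eq_twoHalf ψ t,
      U₃_apply,
      Torus.integral_inner_twoHalf_convect_eq_add ((hΨ.isSmooth_slice t).isContDiff (by simp))
        ((hΨ₃.isSmooth_slice t).isContDiff (by simp))
        (integrable_inner_convect_slice hΨ (memLp_U₂ t)) (by simp)]
    simp
  have hBint : ∫ t in Ioo (0 : ℝ) 1, ∫ x, ⟪U₃ t x, FunctionSpaces.Torus.convect (U₃ t) (ψ t) x⟫ =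
      ∫ t in Ioo (0 : ℝ) 1,
        ∫ y, ⟪U₂ t y, FunctionSpaces.Torus.convect (U₂ t) (Torus.planarTest ψ t) y⟫ :=
    setIntegral_congr_fun measurableSet_Ioo hB
  -- Step 4: the planar identity, split
  have hE := U₂_weakIdentity hΨ hΨdiv
  rw [setIntegral_weakIntegrand_eq_add hum hu2 hCu hΨ] at hE
  rw [hAint, hBint]
  exact hE

/-- **The lift `U₃` is a weak Euler solution on `T³ × (0,1)`** in the accepted sense
`Torus.IsWeakNSSolutionOn 1 0 U₃` (= `IsWeakEulerSolution 1 U₃`).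
[cite: BardosTitiWiedemann2012, Cor. 2, proof] -/
theorem U₃_isWeak : FunctionSpaces.Torus.IsWeakNSSolutionOn 1 0 U₃ := by
  refine ⟨FunctionSpaces.Torus.aestronglyMeasurable_stLift_of_uncurry
      aestronglyMeasurable_uncurry_U₃,
    ?_, ?_, fun ψ hψ hdiv => ?_⟩
  · calc ∫⁻ t in Ioo (0 : ℝ) 1, ∫⁻ x, ‖U₃ t x‖ₑ ^ 2
        ≤ ∫⁻ _ in Ioo (0 : ℝ) 1, (4 : ℝ≥0∞) := by
          refine lintegral_mono fun t => ?_
          calc ∫⁻ x, ‖U₃ t x‖ₑ ^ 2 ≤ ∫⁻ _ : 𝕋³, (4 : ℝ≥0∞) :=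
                lintegral_mono fun x => enorm_sq_le_four (norm_U₃_le t x)
            _ = 4 := by simp
      _ < ∞ := by simp
  · filter_upwards [ae_isWeaklyDivFree_U₂] with t ht
    exact Torus.isWeaklyDivFree_twoHalf (memLp_U₂ t) (memLp_const 0) ht
  · have h := U₃_weakIdentity hψ.1 hdiv
    simpa using h

/-! ## §E The energy of `U₃` -/

/-- The energy of the lift is the planar energy: `∫_{T³} ‖U₃(t)‖² = ∫_{ℝ²} ‖u(t)‖²`. [folklore] -/
theorem integral_norm_sq_U₃ (t : ℝ) : ∫ x, ‖U₃ t x‖ ^ 2 = ∫ Y, ‖uW t Y‖ ^ 2 := by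
  have h1 : ∫ x, ‖U₃ t x‖ ^ 2 = ∫ y, ‖U₂ t y‖ ^ 2 := by
    simp_rw [norm_U₃]
    exact integral_comp_planarProj (b := fun y => ‖U₂ t y‖ ^ 2)
      ((measurable_U₂ t).norm.pow_const 2).aestronglyMeasurable
  rw [h1]
  calc ∫ y, ‖U₂ t y‖ ^ 2 = ∫ Y in unitCube (Fin 2), lift (fun y => ‖U₂ t y‖ ^ 2) Y :=
        integral_eq_integral_lift_holds _
    _ = ∫ Y in unitCube (Fin 2), ‖uW t Y‖ ^ 2 :=
        setIntegral_congr_fun measurableSet_unitCube fun Y hY => by rw [lift_apply, U₂_proj hY]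
    _ = ∫ Y, ‖uW t Y‖ ^ 2 := by
        refine setIntegral_eq_integral_of_forall_compl_eq_zero fun Y hY => ?_
        rw [uW_eq_zero_of_space fun h => hY (disc_subset_unitCube h), norm_zero]
        norm_num

/-- Before the flow is switched on the energy vanishes: `E(U₃(t)) = 0` for `t ∉ (1/4, 3/4)`.
[folklore] -/
theorem energyProfile_U₃_eq_zero {t : ℝ} (ht : t ∉ Ioo (1 / 4 : ℝ) (3 / 4)) :
    energyProfile U₃ t = 0 := by
  rw [energyProfile, FunctionSpaces.Torus.kineticEnergy, integral_norm_sq_U₃]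
  simp [uW_eq_zero_of_time ht]

/-- The positive energy level `e₀ = |B|` of the flow. [folklore] -/
def eLevel : ℝ := (volume disc).toReal

/-- `e₀ > 0` (a ball has positive finite measure). [folklore] -/
theorem eLevel_pos : 0 < eLevel :=
  ENNReal.toReal_pos volume_disc_pos.ne' volume_disc_lt_top.ne

/-- While the flow is on, the energy is a.e. equal to `|B|`: for a.e. `t ∈ (1/4, 3/4)`,
`E(U₃(t)) = ½ ∫_B |V(t, ·)|² = |B|` (`|V|² = 2` a.e. on the cylinder, Fubini). [folklore] -/
theorem ae_energyProfile_U₃_eq :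
    ∀ᵐ t ∂(volume : Measure ℝ), t ∈ Ioo (1 / 4 : ℝ) (3 / 4) → energyProfile U₃ t = eLevel := by
  have h1 : ∀ᵐ z ∂(volume : Measure (ℝ × E²)), z ∈ cyl → ‖cdkField z‖ ^ 2 = 2 :=
    (ae_restrict_iff' measurableSet_cyl).1 ae_norm_sq_cdkField
  rw [Measure.volume_eq_prod] at h1
  filter_upwards [Measure.ae_ae_of_ae_prod h1] with t ht htI
  have hae : (fun Y => ‖uW t Y‖ ^ 2) =ᵐ[volume] disc.indicator fun _ => (2 : ℝ) := by
    filter_upwards [ht] with Y hY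
    by_cases hYd : Y ∈ disc
    · have hz : (t, Y) ∈ cyl := mem_cyl.2 ⟨htI, hYd⟩
      rw [indicator_of_mem hYd, uW_of_mem hz, hY hz]
    · rw [indicator_of_notMem hYd, uW_eq_zero_of_space hYd, norm_zero]
      norm_num
  rw [energyProfile, FunctionSpaces.Torus.kineticEnergy, integral_norm_sq_U₃, integral_congr_ae hae,
    integral_indicator_const _ measurableSet_disc, eLevel, smul_eq_mul, measureReal_def]
  ring

/-- **The energy of `U₃` is not a.e. constant on `(0,1)`**: it vanishes on `(0, 1/4)` and
equals `|B| > 0` a.e. on `(1/4, 3/4)`. [folklore] -/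
theorem not_conservesEnergyAEOn_U₃ : ¬ConservesEnergyAEOn 1 U₃ := by
  intro h
  obtain ⟨c, hc⟩ := (conservesEnergyAEOn_iff_exists_ae_eq_const one_pos).1 h
  -- on `(0, 1/4)` the constant is `0`
  have hc0 : c = 0 := by
    have hsub : Ioo (0 : ℝ) (1 / 4) ⊆ Ioo 0 1 := Ioo_subset_Ioo le_rfl (by norm_num)
    have h1 : ∀ᵐ t ∂(volume.restrict (Ioo (0 : ℝ) (1 / 4))), energyProfile U₃ t = c :=
      ae_restrict_of_ae_restrict_of_subset hsub hc
    have h2 : ∀ᵐ t ∂(volume.restrict (Ioo (0 : ℝ) (1 / 4))), t ∈ Ioo (0 : ℝ) (1 / 4) :=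
      ae_restrict_mem measurableSet_Ioo
    have hne : (volume.restrict (Ioo (0 : ℝ) (1 / 4))) ≠ 0 := by
      rw [Ne, Measure.restrict_eq_zero, Real.volume_Ioo]
      norm_num
    haveI : (ae (volume.restrict (Ioo (0 : ℝ) (1 / 4)))).NeBot := ae_neBot.mpr hne
    obtain ⟨t, ht1, ht2⟩ := (h1.and h2).exists
    rw [← ht1, energyProfile_U₃_eq_zero fun h' => by linarith [h'.1, ht2.2]]
  -- on `(1/4, 3/4)` the constant is `|B| > 0`
  have hsub : Ioo (1 / 4 : ℝ) (3 / 4) ⊆ Ioo 0 1 := Ioo_subset_Ioo (by norm_num) (by norm_num)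
  have h1 : ∀ᵐ t ∂(volume.restrict (Ioo (1 / 4 : ℝ) (3 / 4))), energyProfile U₃ t = c :=
    ae_restrict_of_ae_restrict_of_subset hsub hc
  have h2 : ∀ᵐ t ∂(volume.restrict (Ioo (1 / 4 : ℝ) (3 / 4))), t ∈ Ioo (1 / 4 : ℝ) (3 / 4) :=
    ae_restrict_mem measurableSet_Ioo
  have h3 : ∀ᵐ t ∂(volume.restrict (Ioo (1 / 4 : ℝ) (3 / 4))),
      t ∈ Ioo (1 / 4 : ℝ) (3 / 4) → energyProfile U₃ t = eLevel :=
    ae_restrict_of_ae ae_energyProfile_U₃_eq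
  have hne : (volume.restrict (Ioo (1 / 4 : ℝ) (3 / 4))) ≠ 0 := by
    rw [Ne, Measure.restrict_eq_zero, Real.volume_Ioo]
    norm_num
  haveI : (ae (volume.restrict (Ioo (1 / 4 : ℝ) (3 / 4)))).NeBot := ae_neBot.mpr hne
  obtain ⟨t, ht1, ht2, ht3⟩ := (h1.and (h2.and h3)).exists
  have : eLevel = 0 := by rw [← ht3 ht2, ht1, hc0]
  exact absurd this eLevel_pos.ne'

end TorusThree

end Onsager1949

/-- **Onsager 1949, dissipation without viscosity — proved.** There is a weak solution of the
incompressible Euler equations on `T³ × (0,1)` whose kinetic energy is not a.e. constant in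
time: the `2½`-dimensional lift `U₃` of the periodised planar convex-integration flow of
Chiodaroli–De Lellis–Kreml 2015, Lemma 3.7 (a special case of De Lellis–Székelyhidi 2009,
Thm. 1.1: a bounded weak Euler flow with compact support in space–time), whose energy is `0`
on `(0, 1/4)` and `|B| > 0` a.e. on `(1/4, 3/4)`. Discharge of the named fact
`Onsager1949_inviscidDissipation`. [cite: Onsager1949, §Turbulence, closing paragraph] -/
theorem Onsager1949_inviscidDissipation_holds : Onsager1949_inviscidDissipation :=
  ⟨1, one_pos, Onsager1949.U₃, Onsager1949.U₃_isWeak, Onsager1949.not_conservesEnergyAEOn_U₃⟩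

end Literature.Analysis.FluidPDE

end
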